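import Summits.Ventures.Crystal3D.Theorems.StickyWulffConstantGenericWallFloorShellCapture
import HarnessLib

/-!
# Frame propagation between overlapping Barlow patches (crux `GenericWallFloor`, line `WallLedgerG`)

HONEST FRAMING. Part of the venture `Summits/Ventures/Crystal3D` (cell `crystal3d-full`), helper
`--supports` the crux `GenericWallFloor` (stmt-Ventures-19480) of `route-Ventures-StickyWulffConstant`,
registered line `WallLedgerG` (planner cf-p1 gen 16), stub `stub_twoSlabAdhesion : TwoSlabAdhesion`.
Companion of `…GenericWallFloorShellCapture` (capture of a moved fcc LATTICE by a Barlow patch).  Here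
the captured object is itself a Barlow patch: two rigid images of close-packed stackings `B(σ₁)`,
`B(σ₂)` (`B(σ) = barlowStacking 1 √(2/3) σ`) share a ball together with its twelve neighbours —
the situation along a chain of radius-2 Barlow patches (`RadiusTwoBarlow`) in a defect-poor filling.
With `M` the linear part of the transition map and `y₁`, `y₂` the two sites of the shared ball:

* `image_const_eq_barlow_const_of_shell` — the capture theorem for EITHER constant stacking `B(ε₁)`
  (`ε₁ = ±1`; `ε₁ = 1` is `image_eq_barlow_const_of_shell`): its unit shell mapped into a contact
  shell of `B(σ)` forces an fcc-type site and `M·B(ε₁) = B(σ k)`;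
* `barlowPos_add_unit_of_fccType` — at an fcc-type site of type `ε` the site plus any unit vector of
  `B(ε)` is again a site (the twelve neighbours ARE `y + Shell(B(ε))`);
* `fccType_of_antipodal_sites` — two neighbours of a site in the layers above and below that are
  antipodal force an fcc-type site (general offsets; `fccType_of_reflected_upper_mem` is the case of
  the neighbour straight above);
* **`frame_fccType_of_shell_transfer`** — fcc-type shared shell: the second site is fcc-type too and
  `M·B(σ₁ k₁) = B(σ₂ k₂)` (the local fcc lattice is transported);
* **`hcpType_of_shell_transfer`** — hcp-type shared shell (`σ₁(k₁−1) ≠ σ₁ k₁`): the second site is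
  hcp-type as well, and antipodal shell vectors go to HORIZONTAL vectors (`(M v) 2 = 0` for the six
  in-layer unit vectors `v`): the hexagonal layer plane — hence the stacking axis up to sign — is
  transported.  (The full frame-class statement `M·Λ₀ ∈ {Λ₀, Λ₀⁻}` at hcp-type junctions is the
  sequel's business.)

WHAT THIS IS NOT: nothing about packings or walls; rung F-C1 not moved.
-/

noncomputable section

namespace Summit.Ventures.Crystal3D.Theorems

open Literature.MathematicalPhysics.StatisticalMechanics
open Literature.Barriers.AtomisticToContinuum (haggLabel_eq_mul_of_const barlowAddSubgroupOfConst)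

/-! ### Sites plus shell vectors at an fcc-type site -/

/-- A unit vector of the constant stacking `B(ε)` is one of its twelve shell sites
`(K, I, J)` with `K ∈ {0, 1, −1}`. -/
theorem exists_site_of_unit_constε {ε : ℤ} (hε : ε = 1 ∨ ε = -1) {w : EuclideanSpace ℝ (Fin 3)}
    (hw : w ∈ barlowStacking 1 (Real.sqrt (2 / 3)) (fun _ : ℤ => ε)) (hw1 : ‖w‖ = 1) :
    ∃ K I J : ℤ, w = barlowPos 1 (Real.sqrt (2 / 3)) (fun _ : ℤ => ε) K I J ∧
      (K = 0 ∨ K = 1 ∨ K = -1) := by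
  have hH : IsHaggSeq (fun _ : ℤ => ε) := fun _ => hε
  obtain ⟨K, I, J, rfl⟩ := hw
  have hd : dist (barlowPos 1 (Real.sqrt (2 / 3)) (fun _ : ℤ => ε) 0 0 0)
      (barlowPos 1 (Real.sqrt (2 / 3)) (fun _ : ℤ => ε) K I J) = 1 := by
    rw [barlowPos_zero, dist_comm, dist_zero_right, hw1]
  rw [dist_barlowPos_eq_iff hH one_pos sqrt_twoThirds_sq] at hd
  refine ⟨K, I, J, rfl, ?_⟩
  rcases hd with ⟨h, -⟩ | ⟨h, -⟩ | ⟨h, -⟩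
  · exact Or.inl h
  · exact Or.inr (Or.inl (by omega))
  · exact Or.inr (Or.inr (by omega))

/-- **At an fcc-type site of type `ε`, site + shell vector of `B(ε)` = site.**  If
`σ (k−1) = σ k = ε` then `y + site(K,I,J) of B(ε)` is the site `(k+K, i+I, j+J)` of `B(σ)` for
`K ∈ {0, 1, −1}`. -/
theorem barlowPos_add_unit_of_fccType {σ : ℤ → ℤ} {k ε : ℤ} (hk : σ k = ε) (hk' : σ (k - 1) = ε)
    (i j K I J : ℤ) (hK : K = 0 ∨ K = 1 ∨ K = -1) :
    barlowPos 1 (Real.sqrt (2 / 3)) σ k i j + barlowPos 1 (Real.sqrt (2 / 3)) (fun _ : ℤ => ε) K I J =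
      barlowPos 1 (Real.sqrt (2 / 3)) σ (k + K) (i + I) (j + J) := by
  have hsucc : haggLabel σ (k + 1) = haggLabel σ k + σ k := haggLabel_succ σ k
  have hpred : haggLabel σ (k + -1) = haggLabel σ k - σ (k - 1) := by
    have := haggLabel_sub_haggLabel_pred σ k
    rw [← sub_eq_add_neg]; linarith
  rcases hK with rfl | rfl | rfl
  · simp only [barlowPos, haggLabel_constε, add_zero]; push_cast; module
  · simp only [barlowPos, haggLabel_constε, hsucc, hk]; push_cast; module
  · simp only [barlowPos, haggLabel_constε, hpred, hk']; push_cast; module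

/-- **Antipodal neighbours above and below force an fcc-type site** (general offsets): if the sites
`(k+1, i', j')` and `(k−1, i'', j'')` of `B(σ)` are antipodal about the site `(k, i, j)`, then
`σ (k−1) = σ k`. -/
theorem fccType_of_antipodal_sites {σ : ℤ → ℤ} (hσ : IsHaggSeq σ) (k i j i' j' i'' j'' : ℤ)
    (h : barlowPos 1 (Real.sqrt (2 / 3)) σ (k + 1) i' j' + barlowPos 1 (Real.sqrt (2 / 3)) σ (k - 1) i'' j'' =
      (2 : ℝ) • barlowPos 1 (Real.sqrt (2 / 3)) σ k i j) :
    σ (k - 1) = σ k := by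
  have h3 : (0 : ℝ) < Real.sqrt 3 := Real.sqrt_pos.2 (by norm_num)
  have hsucc : haggLabel σ (k + 1) = haggLabel σ k + σ k := haggLabel_succ σ k
  have hpred : haggLabel σ (k - 1) = haggLabel σ k - σ (k - 1) := by
    have := haggLabel_sub_haggLabel_pred σ k; linarith
  have e1 := congrArg (fun q : EuclideanSpace ℝ (Fin 3) => q 1) h
  simp only [PiLp.add_apply, PiLp.smul_apply, smul_eq_mul, barlowPos_apply_one, hsucc, hpred] at e1
  push_cast at e1
  have e1' : (3 : ℝ) * ((j' : ℝ) + j'' - 2 * j) = (σ (k - 1) : ℝ) - σ k := by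
    have : Real.sqrt 3 * (3 * ((j' : ℝ) + j'' - 2 * j) - ((σ (k - 1) : ℝ) - σ k)) = 0 := by
      nlinarith [e1]
    have := (mul_eq_zero.1 this).resolve_left h3.ne'
    linarith
  have e1Z : 3 * (j' + j'' - 2 * j) = σ (k - 1) - σ k := by exact_mod_cast e1'
  rcases hσ (k - 1) with h1 | h1 <;> rcases hσ k with h2 | h2 <;> omega

/-- **A site with an antipodal pair of non-horizontal neighbours is fcc-type.**  If `y ± v` are both
points of `B(σ)` at distance `1` from the site `y = (k,i,j)` and `v` is not horizontal (`v 2 ≠ 0`),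
then `σ (k−1) = σ k`. -/
theorem fccType_of_antipodal_pair {σ : ℤ → ℤ} (hσ : IsHaggSeq σ) (k i j : ℤ)
    (v : EuclideanSpace ℝ (Fin 3)) (hv2 : v 2 ≠ 0)
    (hp : barlowPos 1 (Real.sqrt (2 / 3)) σ k i j + v ∈ barlowStacking 1 (Real.sqrt (2 / 3)) σ)
    (hm : barlowPos 1 (Real.sqrt (2 / 3)) σ k i j - v ∈ barlowStacking 1 (Real.sqrt (2 / 3)) σ)
    (hv : ‖v‖ = 1) : σ (k - 1) = σ k := by
  set y := barlowPos 1 (Real.sqrt (2 / 3)) σ k i j with hy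
  have hH : (0 : ℝ) < Real.sqrt (2 / 3) := Real.sqrt_pos.2 (by norm_num)
  obtain ⟨k', i', j', e'⟩ := hp
  obtain ⟨k'', i'', j'', e''⟩ := hm
  -- the layers of `y ± v`
  have hd' : dist y (barlowPos 1 (Real.sqrt (2 / 3)) σ k' i' j') = 1 := by
    rw [← e', dist_self_add_right, hv]
  have hd'' : dist y (barlowPos 1 (Real.sqrt (2 / 3)) σ k'' i'' j'') = 1 := by
    rw [← e'', dist_eq_norm, sub_sub_cancel, hv]
  rw [hy, dist_barlowPos_eq_iff hσ one_pos sqrt_twoThirds_sq] at hd' hd''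
  -- height bookkeeping: `v 2 = (k' − k) H = (k − k'') H`
  have e2' := congrArg (fun q : EuclideanSpace ℝ (Fin 3) => q 2) e'
  have e2'' := congrArg (fun q : EuclideanSpace ℝ (Fin 3) => q 2) e''
  simp only [PiLp.add_apply, PiLp.sub_apply, hy, barlowPos_apply_two] at e2' e2''
  have hsum : barlowPos 1 (Real.sqrt (2 / 3)) σ k' i' j' + barlowPos 1 (Real.sqrt (2 / 3)) σ k'' i'' j'' =
      (2 : ℝ) • y := by rw [← e', ← e'']; module
  rcases hd' with ⟨rfl, -⟩ | ⟨rfl, -⟩ | ⟨rfl, -⟩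
  · exact absurd (by linarith [e2'] : v 2 = 0) hv2
  · -- `y + v` above, so `y − v` below
    rcases hd'' with ⟨rfl, -⟩ | ⟨rfl, -⟩ | ⟨rfl, -⟩
    · exact absurd (by linarith [e2''] : v 2 = 0) hv2
    · exfalso
      have : (2 : ℝ) * Real.sqrt (2 / 3) = 0 := by push_cast at e2' e2''; linarith
      linarith
    · exact fccType_of_antipodal_sites hσ k i j i' j' i'' j'' (by rw [hy] at hsum; exact hsum)
  · rcases hd'' with ⟨rfl, -⟩ | ⟨rfl, -⟩ | ⟨rfl, -⟩
    · exact absurd (by linarith [e2''] : v 2 = 0) hv2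
    · exact fccType_of_antipodal_sites hσ k i j i'' j'' i' j'
        (by rw [hy] at hsum; rw [← hsum]; module)
    · exfalso
      have : (2 : ℝ) * Real.sqrt (2 / 3) = 0 := by push_cast at e2' e2''; linarith
      linarith

/-! ### Capture of either constant stacking `B(±1)` -/

/-- **Shell capture for `B(ε₁)`, `ε₁ = ±1`** (the case `ε₁ = 1` is `image_eq_barlow_const_of_shell`):
if a linear isometry `M` maps the twelve unit vectors of `B(ε₁)` into the contact shell of the site
`y = (k,i,j)` of `B(σ)`, then the site is fcc-type and `M·B(ε₁) = B(σ k)`. -/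
theorem image_const_eq_barlow_const_of_shell {σ : ℤ → ℤ} (hσ : IsHaggSeq σ) {ε₁ : ℤ}
    (hε₁ : ε₁ = 1 ∨ ε₁ = -1) (M : EuclideanSpace ℝ (Fin 3) ≃ₗᵢ[ℝ] EuclideanSpace ℝ (Fin 3))
    (k i j : ℤ)
    (hshell : ∀ w ∈ barlowStacking 1 (Real.sqrt (2 / 3)) (fun _ : ℤ => ε₁), ‖w‖ = 1 →
      barlowPos 1 (Real.sqrt (2 / 3)) σ k i j + M w ∈ barlowStacking 1 (Real.sqrt (2 / 3)) σ) :
    σ (k - 1) = σ k ∧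
      M '' barlowStacking 1 (Real.sqrt (2 / 3)) (fun _ : ℤ => ε₁) =
        barlowStacking 1 (Real.sqrt (2 / 3)) (fun _ : ℤ => σ k) := by
  classical
  have hH₁ : IsHaggSeq (fun _ : ℤ => ε₁) := fun _ => hε₁
  set G₁ : AddSubgroup (EuclideanSpace ℝ (Fin 3)) :=
    barlowAddSubgroupOfConst 1 (Real.sqrt (2 / 3)) (fun _ : ℤ => ε₁) (fun _ => rfl) with hG₁
  have hG₁mem : ∀ w, w ∈ G₁ ↔ w ∈ barlowStacking 1 (Real.sqrt (2 / 3)) (fun _ : ℤ => ε₁) :=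
    fun w => Iff.rfl
  set Gε : AddSubgroup (EuclideanSpace ℝ (Fin 3)) :=
    barlowAddSubgroupOfConst 1 (Real.sqrt (2 / 3)) (fun _ : ℤ => σ k) (fun _ => rfl) with hGε
  have hGεmem : ∀ w, w ∈ Gε ↔ w ∈ barlowStacking 1 (Real.sqrt (2 / 3)) (fun _ : ℤ => σ k) :=
    fun w => Iff.rfl
  set y : EuclideanSpace ℝ (Fin 3) := barlowPos 1 (Real.sqrt (2 / 3)) σ k i j with hydef
  set S₀ : Set (EuclideanSpace ℝ (Fin 3)) :=
    {w | w ∈ barlowStacking 1 (Real.sqrt (2 / 3)) (fun _ : ℤ => ε₁) ∧ ‖w‖ = 1} with hS₀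
  set T : Set (EuclideanSpace ℝ (Fin 3)) :=
    {q | q ∈ barlowStacking 1 (Real.sqrt (2 / 3)) σ ∧ dist y q = 1} with hT
  have h0Λ : (0 : EuclideanSpace ℝ (Fin 3)) ∈ barlowStacking 1 (Real.sqrt (2 / 3)) (fun _ : ℤ => ε₁) :=
    ⟨0, 0, 0, (barlowPos_zero _ _).symm⟩
  have hS₀card : S₀.ncard = 12 := by
    have h12 := ncard_touching_eq_twelve hH₁ one_pos sqrt_twoThirds_sq h0Λ
    have hset : S₀ = {w | w ∈ barlowStacking 1 (Real.sqrt (2 / 3)) (fun _ : ℤ => ε₁) ∧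
        dist (0 : EuclideanSpace ℝ (Fin 3)) w = 1} := by
      ext w
      simp only [hS₀, Set.mem_setOf_eq, dist_comm (0 : EuclideanSpace ℝ (Fin 3)), dist_zero_right]
    rw [hset]; exact h12
  have hTcard : T.ncard = 12 := ncard_touching_eq_twelve hσ one_pos sqrt_twoThirds_sq ⟨k, i, j, rfl⟩
  have hTfin : T.Finite := Set.finite_of_ncard_ne_zero (by rw [hTcard]; norm_num)
  set f : EuclideanSpace ℝ (Fin 3) → EuclideanSpace ℝ (Fin 3) := fun w => y + M w with hf
  have hfinj : Function.Injective f := fun a b h => M.injective (add_left_cancel h)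
  have hIT : f '' S₀ ⊆ T := by
    rintro _ ⟨w, ⟨hwΛ, hw1⟩, rfl⟩
    exact ⟨hshell w hwΛ hw1, by rw [hf, dist_self_add_right, LinearIsometryEquiv.norm_map, hw1]⟩
  have hIeqT : f '' S₀ = T :=
    Set.eq_of_subset_of_ncard_le hIT (by rw [hTcard, Set.ncard_image_of_injective _ hfinj, hS₀card])
      hTfin
  set qp : EuclideanSpace ℝ (Fin 3) := barlowPos 1 (Real.sqrt (2 / 3)) σ (k + 1) i j with hqp
  have hqpT : qp ∈ T := ⟨⟨k + 1, i, j, rfl⟩, dist_barlowPos_succ_self hσ k i j⟩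
  rw [← hIeqT] at hqpT
  obtain ⟨w₀, ⟨hw₀Λ, hw₀1⟩, hw₀⟩ := hqpT
  have hMw₀ : M w₀ = qp - y := by rw [← hw₀, hf]; simp
  have hnegw₀ : -w₀ ∈ S₀ := ⟨(hG₁mem _).1 (G₁.neg_mem ((hG₁mem _).2 hw₀Λ)), by rw [norm_neg, hw₀1]⟩
  have hrefl : y - (qp - y) ∈ barlowStacking 1 (Real.sqrt (2 / 3)) σ := by
    have := hshell (-w₀) hnegw₀.1 hnegw₀.2
    rwa [map_neg, hMw₀, ← sub_eq_add_neg] at this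
  have hε : σ (k - 1) = σ k := fccType_of_reflected_upper_mem hσ k i j hrefl
  refine ⟨hε, ?_⟩
  have hMS₀ : ∀ w ∈ S₀, M w ∈ barlowStacking 1 (Real.sqrt (2 / 3)) (fun _ : ℤ => σ k) := by
    rintro w hw
    have hfw : f w ∈ T := hIeqT ▸ ⟨w, hw, rfl⟩
    obtain ⟨⟨k', i', j', e⟩, hd⟩ := hfw
    have hMw : M w = barlowPos 1 (Real.sqrt (2 / 3)) σ k' i' j' - y := by
      rw [← e, hf]; simp
    rw [e] at hd
    rw [hMw, hydef, barlowPos_sub_eq_of_fccType hσ rfl hε i j k' i' j' hd]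
    exact ⟨_, _, _, rfl⟩
  apply Set.Subset.antisymm
  · rintro _ ⟨p, ⟨K, I, J, rfl⟩, rfl⟩
    obtain ⟨nu, nv, nf⟩ := norm_barlowPos_generators hH₁
    have hu := hMS₀ _ ⟨⟨0, 1, 0, rfl⟩, nu⟩
    have hv := hMS₀ _ ⟨⟨0, 0, 1, rfl⟩, nv⟩
    have hf' := hMS₀ _ ⟨⟨1, 0, 0, rfl⟩, nf⟩
    rw [barlowPos_constε_eq_combo _ ε₁ K I J, map_add, map_add, map_smul, map_smul, map_smul,
      Int.cast_smul_eq_zsmul, Int.cast_smul_eq_zsmul, Int.cast_smul_eq_zsmul]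
    exact (hGεmem _).1 (Gε.add_mem (Gε.add_mem (Gε.zsmul_mem ((hGεmem _).2 hu) I)
      (Gε.zsmul_mem ((hGεmem _).2 hv) J)) (Gε.zsmul_mem ((hGεmem _).2 hf') K))
  · obtain ⟨gu, gv, gf⟩ := barlowPos_add_generators (σ := σ) k i j
    have pre : ∀ g : EuclideanSpace ℝ (Fin 3),
        y + g ∈ barlowStacking 1 (Real.sqrt (2 / 3)) σ → dist y (y + g) = 1 →
        ∃ a ∈ barlowStacking 1 (Real.sqrt (2 / 3)) (fun _ : ℤ => ε₁), M a = g := by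
      intro g hg hd
      have hgT : y + g ∈ T := ⟨hg, hd⟩
      rw [← hIeqT] at hgT
      obtain ⟨a, ⟨haΛ, -⟩, ha⟩ := hgT
      exact ⟨a, haΛ, by simpa [hf] using ha⟩
    obtain ⟨a, haΛ, ha⟩ := pre _ (by rw [hydef, gu]; exact ⟨_, _, _, rfl⟩)
      (by rw [hydef, gu]; exact dist_barlowPos_right hσ k i j)
    obtain ⟨b, hbΛ, hb⟩ := pre _ (by rw [hydef, gv]; exact ⟨_, _, _, rfl⟩)
      (by rw [hydef, gv]; exact dist_barlowPos_up hσ k i j)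
    obtain ⟨c, hcΛ, hc⟩ := pre _ (by rw [hydef, gf]; exact ⟨_, _, _, rfl⟩)
      (by rw [hydef, gf]; exact dist_barlowPos_succ_self hσ k i j)
    rintro q ⟨K, I, J, rfl⟩
    refine ⟨(I : ℝ) • a + (J : ℝ) • b + (K : ℝ) • c, ?_, ?_⟩
    · rw [Int.cast_smul_eq_zsmul, Int.cast_smul_eq_zsmul, Int.cast_smul_eq_zsmul]
      exact (hG₁mem _).1 (G₁.add_mem (G₁.add_mem (G₁.zsmul_mem ((hG₁mem _).2 haΛ) I)
        (G₁.zsmul_mem ((hG₁mem _).2 hbΛ) J)) (G₁.zsmul_mem ((hG₁mem _).2 hcΛ) K))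
    · rw [map_add, map_add, map_smul, map_smul, map_smul, ha, hb, hc]
      exact (barlowPos_constε_eq_combo _ (σ k) K I J).symm

/-! ### Transfer between two stackings sharing a full shell -/

/-- **Shell transfer is onto.**  If `q ↦ y₂ + M (q − y₁)` carries the contact shell of the site
`y₁` of `B(σ₁)` into `B(σ₂)` (`y₂ ∈ B(σ₂)`), then it carries it ONTO the contact shell of `y₂`
(both shells have twelve points). -/
theorem shell_transfer_surjective {σ₁ σ₂ : ℤ → ℤ} (hσ₁ : IsHaggSeq σ₁) (hσ₂ : IsHaggSeq σ₂)
    (M : EuclideanSpace ℝ (Fin 3) ≃ₗᵢ[ℝ] EuclideanSpace ℝ (Fin 3)) {y₁ y₂ : EuclideanSpace ℝ (Fin 3)}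
    (hy₁ : y₁ ∈ barlowStacking 1 (Real.sqrt (2 / 3)) σ₁)
    (hy₂ : y₂ ∈ barlowStacking 1 (Real.sqrt (2 / 3)) σ₂)
    (htr : ∀ q ∈ barlowStacking 1 (Real.sqrt (2 / 3)) σ₁, dist y₁ q = 1 →
      y₂ + M (q - y₁) ∈ barlowStacking 1 (Real.sqrt (2 / 3)) σ₂)
    {q₂ : EuclideanSpace ℝ (Fin 3)} (hq₂ : q₂ ∈ barlowStacking 1 (Real.sqrt (2 / 3)) σ₂)
    (hd₂ : dist y₂ q₂ = 1) :
    ∃ q ∈ barlowStacking 1 (Real.sqrt (2 / 3)) σ₁, dist y₁ q = 1 ∧ y₂ + M (q - y₁) = q₂ := by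
  classical
  set T₁ : Set (EuclideanSpace ℝ (Fin 3)) :=
    {q | q ∈ barlowStacking 1 (Real.sqrt (2 / 3)) σ₁ ∧ dist y₁ q = 1} with hT₁
  set T₂ : Set (EuclideanSpace ℝ (Fin 3)) :=
    {q | q ∈ barlowStacking 1 (Real.sqrt (2 / 3)) σ₂ ∧ dist y₂ q = 1} with hT₂
  have h₁ : T₁.ncard = 12 := ncard_touching_eq_twelve hσ₁ one_pos sqrt_twoThirds_sq hy₁
  have h₂ : T₂.ncard = 12 := ncard_touching_eq_twelve hσ₂ one_pos sqrt_twoThirds_sq hy₂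
  have hT₂fin : T₂.Finite := Set.finite_of_ncard_ne_zero (by rw [h₂]; norm_num)
  set f : EuclideanSpace ℝ (Fin 3) → EuclideanSpace ℝ (Fin 3) := fun q => y₂ + M (q - y₁) with hf
  have hfinj : Function.Injective f := fun a b h =>
    sub_left_injective (M.injective (add_left_cancel h))
  have hIT : f '' T₁ ⊆ T₂ := by
    rintro _ ⟨q, ⟨hq, hd⟩, rfl⟩
    refine ⟨htr q hq hd, ?_⟩
    rw [hf, dist_self_add_right, LinearIsometryEquiv.norm_map, ← dist_eq_norm, dist_comm, hd]
  have hIeqT : f '' T₁ = T₂ :=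
    Set.eq_of_subset_of_ncard_le hIT (by rw [h₂, Set.ncard_image_of_injective _ hfinj, h₁]) hT₂fin
  have : q₂ ∈ f '' T₁ := by rw [hIeqT]; exact ⟨hq₂, hd₂⟩
  obtain ⟨q, ⟨hq, hd⟩, hfq⟩ := this
  exact ⟨q, hq, hd, hfq⟩

/-- **fcc-type junction: the local fcc lattice is transported.**  If the ball shared by two
Barlow patches has an fcc-type site `(k₁,i₁,j₁)` in `B(σ₁)` and the transition
`q ↦ y₂ + M(q − y₁)` carries its `B(σ₁)`-shell into `B(σ₂)`, then its site `(k₂,i₂,j₂)` in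
`B(σ₂)` is fcc-type too and `M·B(σ₁ k₁) = B(σ₂ k₂)`. -/
theorem frame_fccType_of_shell_transfer {σ₁ σ₂ : ℤ → ℤ} (hσ₁ : IsHaggSeq σ₁) (hσ₂ : IsHaggSeq σ₂)
    (M : EuclideanSpace ℝ (Fin 3) ≃ₗᵢ[ℝ] EuclideanSpace ℝ (Fin 3)) (k₁ i₁ j₁ k₂ i₂ j₂ : ℤ)
    (hfcc : σ₁ (k₁ - 1) = σ₁ k₁)
    (htr : ∀ q ∈ barlowStacking 1 (Real.sqrt (2 / 3)) σ₁,
      dist (barlowPos 1 (Real.sqrt (2 / 3)) σ₁ k₁ i₁ j₁) q = 1 →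
      barlowPos 1 (Real.sqrt (2 / 3)) σ₂ k₂ i₂ j₂ + M (q - barlowPos 1 (Real.sqrt (2 / 3)) σ₁ k₁ i₁ j₁) ∈
        barlowStacking 1 (Real.sqrt (2 / 3)) σ₂) :
    σ₂ (k₂ - 1) = σ₂ k₂ ∧
      M '' barlowStacking 1 (Real.sqrt (2 / 3)) (fun _ : ℤ => σ₁ k₁) =
        barlowStacking 1 (Real.sqrt (2 / 3)) (fun _ : ℤ => σ₂ k₂) := by
  refine image_const_eq_barlow_const_of_shell hσ₂ (hσ₁ k₁) M k₂ i₂ j₂ fun w hw hw1 => ?_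
  obtain ⟨K, I, J, rfl, hK⟩ := exists_site_of_unit_constε (hσ₁ k₁) hw hw1
  have hsite := barlowPos_add_unit_of_fccType (σ := σ₁) rfl hfcc i₁ j₁ K I J hK
  have := htr _ ⟨k₁ + K, i₁ + I, j₁ + J, rfl⟩ (by rw [← hsite, dist_self_add_right, hw1])
  rwa [← hsite, add_sub_cancel_left] at this

/-- **hcp-type junction: the stacking type and the layer plane are transported.**  If the shared
ball has an hcp-type site in `B(σ₁)` (`σ₁(k₁−1) ≠ σ₁ k₁`) and the transition carries its
`B(σ₁)`-shell into `B(σ₂)`, then (i) its site in `B(σ₂)` is hcp-type, and (ii) the six in-layer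
unit vectors are carried to HORIZONTAL vectors: `(M v) 2 = 0` whenever `y₁ ± v` are both points of
`B(σ₁)` at distance `1` (at an hcp-type site these are exactly the in-layer neighbours). -/
theorem hcpType_of_shell_transfer {σ₁ σ₂ : ℤ → ℤ} (hσ₁ : IsHaggSeq σ₁) (hσ₂ : IsHaggSeq σ₂)
    (M : EuclideanSpace ℝ (Fin 3) ≃ₗᵢ[ℝ] EuclideanSpace ℝ (Fin 3)) (k₁ i₁ j₁ k₂ i₂ j₂ : ℤ)
    (hhcp : σ₁ (k₁ - 1) ≠ σ₁ k₁)
    (htr : ∀ q ∈ barlowStacking 1 (Real.sqrt (2 / 3)) σ₁,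
      dist (barlowPos 1 (Real.sqrt (2 / 3)) σ₁ k₁ i₁ j₁) q = 1 →
      barlowPos 1 (Real.sqrt (2 / 3)) σ₂ k₂ i₂ j₂ + M (q - barlowPos 1 (Real.sqrt (2 / 3)) σ₁ k₁ i₁ j₁) ∈
        barlowStacking 1 (Real.sqrt (2 / 3)) σ₂) :
    σ₂ (k₂ - 1) ≠ σ₂ k₂ ∧
      ∀ v : EuclideanSpace ℝ (Fin 3), ‖v‖ = 1 →
        barlowPos 1 (Real.sqrt (2 / 3)) σ₁ k₁ i₁ j₁ + v ∈ barlowStacking 1 (Real.sqrt (2 / 3)) σ₁ →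
        barlowPos 1 (Real.sqrt (2 / 3)) σ₁ k₁ i₁ j₁ - v ∈ barlowStacking 1 (Real.sqrt (2 / 3)) σ₁ →
        (M v) 2 = 0 := by
  set y₁ := barlowPos 1 (Real.sqrt (2 / 3)) σ₁ k₁ i₁ j₁ with hy₁
  set y₂ := barlowPos 1 (Real.sqrt (2 / 3)) σ₂ k₂ i₂ j₂ with hy₂
  -- (i): an fcc-type target would reflect back an fcc-type source
  have hi : σ₂ (k₂ - 1) ≠ σ₂ k₂ := by
    intro hε₂
    -- the image of the upper neighbour of `y₁` and its antipode about `y₂`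
    set qp := barlowPos 1 (Real.sqrt (2 / 3)) σ₁ (k₁ + 1) i₁ j₁ with hqp
    have hqpB : qp ∈ barlowStacking 1 (Real.sqrt (2 / 3)) σ₁ := ⟨_, _, _, rfl⟩
    have hqpd : dist y₁ qp = 1 := dist_barlowPos_succ_self hσ₁ k₁ i₁ j₁
    have himg := htr qp hqpB hqpd
    obtain ⟨k', i', j', e⟩ := himg
    have hd' : dist y₂ (barlowPos 1 (Real.sqrt (2 / 3)) σ₂ k' i' j') = 1 := by
      rw [← e, dist_self_add_right, LinearIsometryEquiv.norm_map, ← dist_eq_norm, dist_comm, hqpd]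
    have hvec : M (qp - y₁) = barlowPos 1 (Real.sqrt (2 / 3)) (fun _ : ℤ => σ₂ k₂) (k' - k₂) (i' - i₂)
        (j' - j₂) := by
      rw [← barlowPos_sub_eq_of_fccType hσ₂ rfl hε₂ i₂ j₂ k' i' j' hd', ← e, hy₂, add_sub_cancel_left]
    -- the antipode `y₂ − M(qp − y₁)` is again a neighbour of `y₂`
    set Gε : AddSubgroup (EuclideanSpace ℝ (Fin 3)) :=
      barlowAddSubgroupOfConst 1 (Real.sqrt (2 / 3)) (fun _ : ℤ => σ₂ k₂) (fun _ => rfl) with hGε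
    have hneg : -M (qp - y₁) ∈ barlowStacking 1 (Real.sqrt (2 / 3)) (fun _ : ℤ => σ₂ k₂) := by
      have : M (qp - y₁) ∈ Gε := by rw [hvec]; exact ⟨_, _, _, rfl⟩
      exact Gε.neg_mem this
    have hneg1 : ‖-M (qp - y₁)‖ = 1 := by
      rw [norm_neg, LinearIsometryEquiv.norm_map, ← dist_eq_norm, dist_comm, hqpd]
    obtain ⟨K, I, J, hKIJ, hK⟩ := exists_site_of_unit_constε (hσ₂ k₂) hneg hneg1
    have hanti : y₂ + -M (qp - y₁) ∈ barlowStacking 1 (Real.sqrt (2 / 3)) σ₂ := by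
      rw [hKIJ, hy₂, barlowPos_add_unit_of_fccType (σ := σ₂) rfl hε₂ i₂ j₂ K I J hK]
      exact ⟨_, _, _, rfl⟩
    have hantid : dist y₂ (y₂ + -M (qp - y₁)) = 1 := by rw [dist_self_add_right, hneg1]
    obtain ⟨q, hq, hqd, hfq⟩ := shell_transfer_surjective hσ₁ hσ₂ M ⟨_, _, _, rfl⟩ ⟨_, _, _, rfl⟩
      htr hanti hantid
    have hq' : q - y₁ = -(qp - y₁) := M.injective (by rw [map_neg]; exact add_left_cancel hfq)
    have hrefl : y₁ - (qp - y₁) ∈ barlowStacking 1 (Real.sqrt (2 / 3)) σ₁ := by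
      have : q = y₁ - (qp - y₁) := by rw [sub_eq_add_neg, ← hq', add_sub_cancel]
      rw [← this]; exact hq
    exact hhcp (fccType_of_reflected_upper_mem hσ₁ k₁ i₁ j₁ hrefl)
  refine ⟨hi, fun v hv hp hm => ?_⟩
  -- (ii): a non-horizontal image would make the target fcc-type
  by_contra h2
  have hp' := htr _ hp (by rw [dist_self_add_right, hv])
  have hm' := htr _ hm (by rw [dist_eq_norm, sub_sub_cancel, hv])
  rw [add_sub_cancel_left] at hp'
  rw [show y₁ - v - y₁ = -v by abel, map_neg, ← sub_eq_add_neg] at hm'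
  exact hi (fccType_of_antipodal_pair hσ₂ k₂ i₂ j₂ (M v) h2 hp' hm'
    (by rw [LinearIsometryEquiv.norm_map, hv]))

end Summit.Ventures.Crystal3D.Theorems

end
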